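import Summits.NavierStokesRegularity.NavierStokesRegularity.Theses.QuantisedSymmetry
import Summits.NavierStokesRegularity.NavierStokesRegularity.Theses.DssFarFieldSlaving
import Summits.NavierStokesRegularity.NavierStokesRegularity.Theorems.QuantisedSymmetryPolyhedralDssProfileExistsDominatesBlowupProfile
import Summits.NavierStokesRegularity.NavierStokesRegularity.Theorems.DssFarFieldSlavingDssTruncationBridge
import Summits.NavierStokesRegularity.NavierStokesRegularity.Theorems.QuantisedSymmetryPolyhedralDssProfileExistsCellOfProfile
import Summits.NavierStokesRegularity.NavierStokesRegularity.Theorems.QuantisedSymmetryLiouvilleKillsProfile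
import HarnessLib

/-!
# Strategist sketch s17 (family `-s`, independent census) — crux `PolyhedralDssProfileExists`

Companion to `STRATEGY-CENSUS-s17.md` (crux item stmt-NavierStokesRegularity-1404, route
QuantisedSymmetry).  Every statement the census leans on that CAN be kernel-checked is checked here,
sorry-free:

* §1 WEAKER INTERMEDIATE.  `W` := the sector-free Type-I DSS profile statement (item stmt-0155,
  `BlowupTypeIDssProfile`).  `crux_implies_W` (the crux dominates W) and `W_decides_summit`
  (W alone already gives `¬ NavierStokesRegularity`, via the PROVED bridge of route DssFarFieldSlaving):
  so the polyhedral clauses of the crux are load-bearing for no summit-level conclusion.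
* §2 DECOMPOSITION.  The best typed split found: `ApproxCells` (ε-approximate polyhedral cells with
  uniform a-priori bounds and a floor exist for every ε) and `CellCompactness` (such families converge to
  an exact nontrivial cell).  `crux_of_split` is the proved assembly; `approxCells_of_crux` is the proved
  COLLAPSE: the crux re-implies `ApproxCells` trivially, so modulo the (provable, content-free w.r.t. NS
  existence) compactness piece the ∃-piece IS the crux — the split is not a redirect.
* §3 STRENGTHEN.  `QuantCrux Λ K` (explicit window for the factor and the Type-I constant) and
  `MinimalWitnessExists` (a witness of least Type-I constant); both imply the crux (`crux_of_quantCrux`,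
  `crux_of_minimalWitness`) and `crux_iff_exists_quantCrux` shows the first is a mere re-indexing.
* §4 NEGATION.  `not_crux_iff`: the counterexample to the crux is exactly the DSS-restricted polyhedral
  Type-I Liouville statement `PolyhedralDssLiouville`; `polyhedralDssLiouville_of_killSwitch` places it
  under the route's kill switch #3 (proved support `LiouvilleKillsProfile`).
-/

namespace Summit.NavierStokesRegularity.NavierStokesRegularity.Cruxes.PolyhedralDssProfileExists.StrategistS17

open MeasureTheory
open Literature.Analysis.FluidPDE

/-- The crux, by name. -/
abbrev Crux : Prop :=
  _root_.Summit.NavierStokesRegularity.NavierStokesRegularity.Theses.QuantisedSymmetry.PolyhedralDssProfileExists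

/-- "`G` is a finite irreducible proper rotation group of `ℝ³`" — the three group clauses of the crux. -/
def IsPolyhedral (G : Subgroup (EuclideanSpace ℝ (Fin 3) ≃ₗᵢ[ℝ] EuclideanSpace ℝ (Fin 3))) : Prop :=
  Finite G ∧
  (∀ g ∈ G, LinearMap.det (g.toLinearEquiv : EuclideanSpace ℝ (Fin 3) →ₗ[ℝ] EuclideanSpace ℝ (Fin 3)) = 1) ∧
  (∀ V : Submodule ℝ (EuclideanSpace ℝ (Fin 3)), (∀ g ∈ G, ∀ v ∈ V, g v ∈ V) → V = ⊥ ∨ V = ⊤)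

/-! ## §1 Weaker intermediate -/

/-- `W` := stmt-NavierStokesRegularity-0155, the sector-free statement "Tsai's Type-I (rotated) λ-DSS
Liouville conjecture fails for some λ" — the weakest DSS-type statement in the tree that still decides the
summit. -/
abbrev W : Prop :=
  _root_.Summit.NavierStokesRegularity.NavierStokesRegularity.Theses.DssFarFieldSlaving.BlowupTypeIDssProfile

/-- The crux dominates `W` (forget the symmetry group). [tree: `stub_dominatesBlowupProfile`] -/
theorem crux_implies_W : Crux → W := by
  intro h
  have h' :=
    _root_.Summit.NavierStokesRegularity.NavierStokesRegularity.Theorems.PolyhedralDssProfileExists.PolyhedralCell.stub_dominatesBlowupProfile h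
  dsimp only [W,
    _root_.Summit.NavierStokesRegularity.NavierStokesRegularity.Theses.DssFarFieldSlaving.BlowupTypeIDssProfile]
  dsimp only [_root_.Summit.NavierStokesRegularity.NavierStokesRegularity.Theses.Blowup.BlowupTypeIDssProfile] at h'
  exact h'

/-- `W` alone decides the summit negatively: the crux-only deciding theorem of route DssFarFieldSlaving
composed with its PROVED bridge `dssTruncationBridge_proof`. -/
theorem W_decides_summit : W → ¬ _root_.NavierStokesRegularity := fun hW =>
  _root_.Summit.NavierStokesRegularity.NavierStokesRegularity.Theses.DssFarFieldSlaving.closes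
    _root_.Summit.NavierStokesRegularity.NavierStokesRegularity.Theorems.dssTruncationBridge_proof hW

/-- Hence the polyhedral clauses of the crux are not load-bearing for the summit conclusion. -/
theorem crux_decides_via_W : Crux → ¬ _root_.NavierStokesRegularity := fun h =>
  W_decides_summit (crux_implies_W h)

/-! ## §2 Decomposition: approximate cells + compactness -/

/-- The exact polyhedral cell on the slab `[-1, -λ⁻²] × ℝ³` (verbatim the cell predicate of
`polyhedralDssProfileExists_iff_cell`). -/
def IsCell (G : Subgroup (EuclideanSpace ℝ (Fin 3) ≃ₗᵢ[ℝ] EuclideanSpace ℝ (Fin 3))) (c : ℝ)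
    (v : ℝ → EuclideanSpace ℝ (Fin 3) → EuclideanSpace ℝ (Fin 3)) : Prop :=
  ContinuousOn (Function.uncurry v) (Set.Icc (-1 : ℝ) (-(c ^ 2)⁻¹) ×ˢ Set.univ) ∧
  (∃ M : ℝ, ∀ t ∈ Set.Icc (-1 : ℝ) (-(c ^ 2)⁻¹), ∀ x, ‖v t x‖ ≤ M) ∧
  (∀ t ∈ Set.Icc (-1 : ℝ) (-(c ^ 2)⁻¹), IsWeaklyDivFree (v t)) ∧
  (∀ s t : ℝ, -1 ≤ s → s < t → t ≤ -(c ^ 2)⁻¹ → ∀ x,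
    v t x = heatFlow (v s) (t - s) x - oseenDuhamel 1 s v v t x) ∧
  (∀ x, v (-(c ^ 2)⁻¹) x = c • v (-1) (c • x)) ∧
  (∀ g ∈ G, ∀ t ∈ Set.Icc (-1 : ℝ) (-(c ^ 2)⁻¹), ∀ x, v t (g x) = g (v t x))

/-- An `ε`-APPROXIMATE cell: every clause of the cell exact except the DSS junction, which holds up to `ε`
in sup norm; with a UNIFORM a-priori bound `A` (sup on the slab and `L⁴` of the datum) and a FLOOR:
the datum has modulus `≥ δ` at some point of the closed ball of radius `R`. This is the object a numerical
search (Galerkin / harmonic balance, EVENMAP-PROTOCOL) actually produces. -/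
def IsApproxCell (G : Subgroup (EuclideanSpace ℝ (Fin 3) ≃ₗᵢ[ℝ] EuclideanSpace ℝ (Fin 3)))
    (c ε A R δ : ℝ) (v : ℝ → EuclideanSpace ℝ (Fin 3) → EuclideanSpace ℝ (Fin 3)) : Prop :=
  ContinuousOn (Function.uncurry v) (Set.Icc (-1 : ℝ) (-(c ^ 2)⁻¹) ×ˢ Set.univ) ∧
  (∀ t ∈ Set.Icc (-1 : ℝ) (-(c ^ 2)⁻¹), ∀ x, ‖v t x‖ ≤ A) ∧
  (∀ t ∈ Set.Icc (-1 : ℝ) (-(c ^ 2)⁻¹), IsWeaklyDivFree (v t)) ∧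
  (∀ s t : ℝ, -1 ≤ s → s < t → t ≤ -(c ^ 2)⁻¹ → ∀ x,
    v t x = heatFlow (v s) (t - s) x - oseenDuhamel 1 s v v t x) ∧
  (∀ x, ‖v (-(c ^ 2)⁻¹) x - c • v (-1) (c • x)‖ ≤ ε) ∧
  (∀ g ∈ G, ∀ t ∈ Set.Icc (-1 : ℝ) (-(c ^ 2)⁻¹), ∀ x, v t (g x) = g (v t x)) ∧
  MemLp (v (-1)) 4 volume ∧ eLpNorm (v (-1)) 4 volume ≤ ENNReal.ofReal A ∧
  (∃ x₀ : EuclideanSpace ℝ (Fin 3), ‖x₀‖ ≤ R ∧ δ ≤ ‖v (-1) x₀‖)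

/-- Piece 1 (the ∃-piece): for some sector `G`, factor `λ` and uniform constants `A, R, δ > 0`,
`ε`-approximate cells exist for EVERY `ε > 0`. -/
def ApproxCells : Prop :=
  ∃ G : Subgroup (EuclideanSpace ℝ (Fin 3) ≃ₗᵢ[ℝ] EuclideanSpace ℝ (Fin 3)), IsPolyhedral G ∧
    ∃ c : ℝ, 1 < c ∧ ∃ A R δ : ℝ, 0 < δ ∧
      ∀ ε > 0, ∃ v : ℝ → EuclideanSpace ℝ (Fin 3) → EuclideanSpace ℝ (Fin 3), IsApproxCell G c ε A R δ v

/-- Piece 2 (parabolic compactness, no NS-existence content): a family of `ε`-approximate cells with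
uniform bounds and a uniform floor has, as `ε → 0`, a limit that is an exact cell with nontrivial `L⁴`
datum (Arzelà–Ascoli from Oseen-kernel equicontinuity on the slab, dominated convergence in the mild
formula and in the weak divergence-free identity, Fatou in `L⁴`, the floor surviving locally uniform
convergence on the compact ball). Size L. -/
def CellCompactness : Prop :=
  ∀ G : Subgroup (EuclideanSpace ℝ (Fin 3) ≃ₗᵢ[ℝ] EuclideanSpace ℝ (Fin 3)), ∀ c : ℝ, 1 < c →
    ∀ A R δ : ℝ, 0 < δ →
      (∀ ε > 0, ∃ v : ℝ → EuclideanSpace ℝ (Fin 3) → EuclideanSpace ℝ (Fin 3), IsApproxCell G c ε A R δ v) →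
      ∃ v : ℝ → EuclideanSpace ℝ (Fin 3) → EuclideanSpace ℝ (Fin 3),
        IsCell G c v ∧ MemLp (v (-1)) 4 volume ∧ ¬ (v (-1) =ᵐ[volume] 0)

/-- ASSEMBLY of the split (proved): the two pieces give the crux, via the cell ⇒ profile concatenation
`polyhedralDssProfileExists_iff_cell` already in the tree. -/
theorem crux_of_split : ApproxCells → CellCompactness → Crux := by
  rintro ⟨G, ⟨hfin, hdet, hirr⟩, c, hc, A, R, δ, hδ, happrox⟩ hK
  obtain ⟨v, hcell, hL4, hnz⟩ := hK G c hc A R δ hδ happrox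
  exact
    _root_.Summit.NavierStokesRegularity.NavierStokesRegularity.Theorems.PolyhedralDssProfileExists.PolyhedralCell.polyhedralDssProfileExists_iff_cell.mpr
      ⟨G, hfin, hdet, hirr, c, hc, v, hcell, hL4, hnz⟩

/-- COLLAPSE of the split (proved): the crux re-implies the ∃-piece trivially (an exact cell is
`ε`-approximate for every `ε`, with its own bound and its own nonzero point as floor). Hence, modulo the
provable compactness piece, `ApproxCells ↔ Crux`: the decomposition moves the whole ∃-content into
piece 1 and is NOT a redirect. -/
theorem approxCells_of_crux : Crux → ApproxCells := by
  intro hX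
  obtain ⟨G, hfin, hdet, hirr, c, hc, v, ⟨hcont, ⟨M, hM⟩, hdiv, hmild, hjunc, hequiv⟩, hL4, hnz⟩ :=
    _root_.Summit.NavierStokesRegularity.NavierStokesRegularity.Theorems.PolyhedralDssProfileExists.PolyhedralCell.polyhedralDssProfileExists_iff_cell.mp hX
  have hpt : ∃ x₀, v (-1) x₀ ≠ 0 := by
    by_contra h
    exact hnz (Filter.Eventually.of_forall fun x => by simpa using not_not.mp (not_exists.mp h x))
  obtain ⟨x₀, hx₀⟩ := hpt
  refine ⟨G, ⟨hfin, hdet, hirr⟩, c, hc, max M (eLpNorm (v (-1)) 4 volume).toReal, ‖x₀‖, ‖v (-1) x₀‖,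
    norm_pos_iff.mpr hx₀, fun ε hε => ⟨v, ?_⟩⟩
  refine ⟨hcont, ?_, hdiv, hmild, ?_, hequiv, hL4, ?_, ⟨x₀, le_rfl, le_rfl⟩⟩
  · intro t ht x
    exact (hM t ht x).trans (le_max_left _ _)
  · intro x
    rw [hjunc x, sub_self, norm_zero]
    exact hε.le
  · calc eLpNorm (v (-1)) 4 volume
        = ENNReal.ofReal (eLpNorm (v (-1)) 4 volume).toReal :=
          (ENNReal.ofReal_toReal hL4.eLpNorm_ne_top).symm
      _ ≤ ENNReal.ofReal (max M (eLpNorm (v (-1)) 4 volume).toReal) :=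
          ENNReal.ofReal_le_ofReal (le_max_right _ _)

/-! ## §3 Strengthen -/

/-- S⁺ (quantitative): the crux with an explicit window `λ ≤ Λ` for the factor and an explicit Type-I
constant `K`. Buys compactness of the witness set (N1 period window, N2 constant gap), i.e. leverage for
Liouville-by-contradiction arguments (Chae–Wolf Thm 1.3 style), none for existence. -/
def QuantCrux (Λ K : ℝ) : Prop :=
  ∃ G : Subgroup (EuclideanSpace ℝ (Fin 3) ≃ₗᵢ[ℝ] EuclideanSpace ℝ (Fin 3)), IsPolyhedral G ∧
    ∃ c : ℝ, 1 < c ∧ c ≤ Λ ∧ ∃ u : ℝ → EuclideanSpace ℝ (Fin 3) → EuclideanSpace ℝ (Fin 3),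
      IsAncientMildSolution 1 u ∧ (∀ t < 0, AEStronglyMeasurable (u t) volume) ∧
      IsDiscretelySelfSimilar c u ∧ HasTypeIDecay K u ∧
      (∀ g ∈ G, ∀ t x, u t (g x) = g (u t x)) ∧ ¬ (∀ t < 0, u t =ᵐ[volume] 0)

theorem crux_of_quantCrux (Λ K : ℝ) : QuantCrux Λ K → Crux := by
  rintro ⟨G, ⟨hfin, hdet, hirr⟩, c, hc, -, u, h1, h2, h3, h4, h5, h6⟩
  exact ⟨G, hfin, hdet, hirr, c, hc, u, h1, h2, h3, ⟨K, h4⟩, h5, h6⟩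

/-- The quantitative form is a mere re-indexing of the crux. -/
theorem crux_iff_exists_quantCrux : Crux ↔ ∃ Λ K : ℝ, QuantCrux Λ K := by
  constructor
  · rintro ⟨G, hfin, hdet, hirr, c, hc, u, h1, h2, h3, ⟨K, h4⟩, h5, h6⟩
    exact ⟨c, K, G, ⟨hfin, hdet, hirr⟩, c, hc, le_rfl, u, h1, h2, h3, h4, h5, h6⟩
  · rintro ⟨Λ, K, h⟩
    exact crux_of_quantCrux Λ K h

/-- A witness with Type-I constant `K` (factor free). -/
def WitnessWith (K : ℝ) : Prop := ∃ Λ : ℝ, QuantCrux Λ K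

/-- S⁺ (critical element): a witness of LEAST Type-I constant exists. Strictly stronger than the crux as
typed (attainment needs compactness in the factor `λ`, which may escape to `∞` along a minimising
sequence); it presupposes a witness, so it buys nothing for ∃, and NS offers no variational structure that
would turn minimality into an equation. -/
def MinimalWitnessExists : Prop := ∃ K : ℝ, WitnessWith K ∧ ∀ K' < K, ¬ WitnessWith K'

theorem crux_of_minimalWitness : MinimalWitnessExists → Crux := by
  rintro ⟨K, ⟨Λ, h⟩, -⟩
  exact crux_of_quantCrux Λ K h

theorem exists_witnessWith_of_crux : Crux → ∃ K : ℝ, WitnessWith K := by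
  intro h
  obtain ⟨Λ, K, hq⟩ := crux_iff_exists_quantCrux.mp h
  exact ⟨K, Λ, hq⟩

/-! ## §4 Negation -/

/-- The counterexample statement: the DSS-restricted polyhedral Type-I Liouville theorem. -/
def PolyhedralDssLiouville : Prop :=
  ∀ G : Subgroup (EuclideanSpace ℝ (Fin 3) ≃ₗᵢ[ℝ] EuclideanSpace ℝ (Fin 3)), IsPolyhedral G →
    ∀ c : ℝ, 1 < c → ∀ u : ℝ → EuclideanSpace ℝ (Fin 3) → EuclideanSpace ℝ (Fin 3),
      IsAncientMildSolution 1 u → (∀ t < 0, AEStronglyMeasurable (u t) volume) →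
      IsDiscretelySelfSimilar c u → ∀ C₀ : ℝ, HasTypeIDecay C₀ u →
      (∀ g ∈ G, ∀ t x, u t (g x) = g (u t x)) → ∀ t < 0, u t =ᵐ[volume] 0

/-- Building a counterexample to the crux IS proving `PolyhedralDssLiouville` (kernel-checked `¬∃ ↔ ∀¬`). -/
theorem not_crux_iff : ¬ Crux ↔ PolyhedralDssLiouville := by
  constructor
  · intro hn G hG c hc u h1 h2 h3 C₀ h4 h5
    by_contra h6
    exact hn ⟨G, hG.1, hG.2.1, hG.2.2, c, hc, u, h1, h2, h3, ⟨C₀, h4⟩, h5, h6⟩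
  · rintro hL ⟨G, hfin, hdet, hirr, c, hc, u, h1, h2, h3, ⟨C₀, h4⟩, h5, h6⟩
    exact h6 (hL G ⟨hfin, hdet, hirr⟩ c hc u h1 h2 h3 C₀ h4 h5)

/-- The route's kill switch #3 (`PolyhedralTypeILiouville`, no DSS hypothesis) implies the counterexample
statement, through the PROVED support `LiouvilleKillsProfile` (#3 → ¬#2). -/
theorem polyhedralDssLiouville_of_killSwitch
    (h3 : _root_.Summit.NavierStokesRegularity.NavierStokesRegularity.Theses.QuantisedSymmetry.PolyhedralTypeILiouville) :
    PolyhedralDssLiouville := by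
  have hk :=
    _root_.Summit.NavierStokesRegularity.NavierStokesRegularity.Theorems.quantisedSymmetry_liouvilleKillsProfile_proof
  exact not_crux_iff.mp (hk h3)

end Summit.NavierStokesRegularity.NavierStokesRegularity.Cruxes.PolyhedralDssProfileExists.StrategistS17
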